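import Summits.BirchSwinnertonDyer.Rank1Residual.X1.LocalPackageTransportGalois
import Summits.BirchSwinnertonDyer.Rank1Residual.X1.LocalStrictPackage
import Summits.BirchSwinnertonDyer.Rank1Residual.X1.LocalPackageParts
import Summits.BirchSwinnertonDyer.Rank1Residual.Additive.ZpTowerKernelH1
import Literature.NumberTheory.EllipticCurves.GreenbergSelmer
import Literature.NumberTheory.EllipticCurves.AnomalousOfRationalTorsionProofs
import HarnessLib

/-!
# THE LOCAL PACKAGE at the prime of `ℚ_n` above `p`, over `ℚ` — `(𝓛, 𝓚 ≤ 𝓛, p²·#𝓚 ≤ #𝓛, hstrict)`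
# of `X1/GeneratorCountLayerAtPStrict` DISCHARGED given the factorisation data
# (cell `b2b-bsdres`, unit `b2b-bsdres-eisenstein-p1`, gen 20; X1R0-GAPMAP §28.4, §29; memo
# `V76-LOCAL-TERM-PLAN.md` §5.2 — (M1-local))

HONEST FRAMING (run/shared/lean/b2b/bsd-rank1-residual/, verbatim in every file): the goal of the
cell is to DELETE the COMBINATION-SHAPED residual classes of the Birch–Swinnerton-Dyer formula for
ALL analytic-rank `≤ 1` elliptic curves over `ℚ` — "full BSD formula for every rank `≤ 1` curve in
class `C`" assembled STRICTLY from published theorems — so that the rank-`≤ 1` remainder becomes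
exactly the CONSTRUCTION-SHAPED classes, which are TYPED (missing-input `Prop`s), NOT attempted.
This is not "finishing BSD". Sub-cell `b2b-bsdres-eisenstein-p1`: research route; NO CLAIM BEYOND
STATED CLASSES; nothing here changes a label; nothing is booked. THEOREMS ONLY — no definition, no
named fact introduced; Tate's local Euler–Poincaré characteristic at `(ℚ_n)_wp` (`hEP`) is a
HYPOTHESIS (named fact of the tree), the factorisation data `(ι₂, ι', τ, hfix)` are HYPOTHESES
constructed in the assembly file (n1011's `exists_place_factorisation`).

## What and why

`E/ℚ` globally minimal elliptic, `p` odd, `p ∤ Δ_E`, `p ∤ a_p`, a RATIONAL POINT OF ORDER `p`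
(so `p` is anomalous), `κ` the cyclotomic `ℤ_p`-extension, `ℚ_n = κ.layer n`, `v ∋ p`, `wp ∣ v` the
place of `ℚ_n` singled out by the factorisation of the chosen embeddings. Then
(`exists_strict_addSubgroup`) there is `𝓛 ≤ H¹((ℚ_n)_wp, E[p])` with `𝓚_wp ≤ 𝓛`, `p² · #𝓚_wp ≤ #𝓛`,
and the strictness clause `hstrict` of FILE 24b: every `y ∈ H¹(ℚ_n, E[p])` with `res_wp y ∈ 𝓛` has
(in fact for every cocycle `φ` of `y`) `localRed(pointsMap(β⁻¹ φ(x))) = Õ` for all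
`x ∈ I_v ∩ Gal(ℚ̄/ℚ_∞)`. Ingredients: the `K`-general package `X1/LocalStrictPackage` at
`K = ℚ_n` with the good reduction of the minimal model over the valuation ring of `|·|_wp`
(§1), `A₀ =` the reductions of `E[p]` (order `p`, §2, transported ordinary filtration),
`hs_anom`/`hI`/`hμ` from `X1/LocalPackageTransportGalois`, `ht` from the rational `p`-torsion point
(`X1/LocalPackageParts`), and `hstrict` (§3) from the package's strictness through the inertia bridge
(`X1/SpectralNormTransport`), the conjugate-embedding cocycle (`X1/LocalPackageParts`) and the
transport of "reduces to `Õ`" (`X1/LocalPackageTransportPoints`).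

References: [GreenbergLNM1716] §2 Prop. 2.4, §3 Lemma 3.4 (p. 89), §5 pp. 114–118;
[MilneADT2006] I Thm. 2.8; [SilvermanAEC2009] VII.§2–3; [SerreGaloisCohomology1997] II.§1.1.
-/

noncomputable section

open scoped Classical NNReal

open Function Field NumberField IsDedekindDomain WeierstrassCurve
  Literature.NumberTheory.EllipticCurves Literature.NumberTheory.GaloisRepresentations
  IsDedekindDomain.HeightOneSpectrum
  Summit.BirchSwinnertonDyer.Rank1Residual.Additive.LocalTransport
  Summit.BirchSwinnertonDyer.Rank1Residual.Additive
  Summit.BirchSwinnertonDyer.Rank1Residual.Additive.ZpTower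
  Summit.BirchSwinnertonDyer.Rank1Residual.X2.GreenbergVatsalReductionDatum
open Literature.NumberTheory.EllipticCurves.GreenbergSelmer (inertiaIn inertiaInToH inertia
  mem_inertiaIn_iff)
open Literature.NumberTheory.GaloisRepresentations.DiscreteGaloisModule (mu MuCarrier)

set_option autoImplicit false

-- NB: no local `[NumberField (κ.layer n)]` hypotheses in this file — the tree's global instance
-- `ZpExtension.numberField_layer` is used throughout; a local copy sends instance search for
-- `Algebra ℚ ℚ_n`-structures down a non-defeq path and times out at `whnf`.

namespace Summit.BirchSwinnertonDyer.Rank1Residual.X1.LocalPackageRat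

variable (W : WeierstrassCurve ℚ) [W.IsElliptic] [W.IsGloballyMinimal] {p : ℕ} [hp : Fact p.Prime]
  (κ : ZpExtension ℚ p) (n : ℕ) (κn : ZpExtension (κ.layer n) p)
  (hκn : ∀ σ : Field.absoluteGaloisGroup (κ.layer n),
    (κn σ).toAdd * (p : ℤ_[p]) ^ n = (κ (resGal (K := ℚ) (κ.layer n) σ)).toAdd)
  {v : HeightOneSpectrum (𝓞 ℚ)} (hpv : ((p : ℕ) : 𝓞 ℚ) ∈ v.asIdeal)
  (hΔ : ¬ (p : ℤ) ∣ minimalDiscriminantInt W)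
  (wp : HeightOneSpectrum (𝓞 (κ.layer n))) [wp.asIdeal.LiesOver v.asIdeal]
  -- the factorisation data (n1011 shape)
  (ι₂ : AlgebraicClosure (v.adicCompletion ℚ) ≃+* AlgebraicClosure (wp.adicCompletion (κ.layer n)))
  (hι₂ : ∀ x : v.adicCompletion ℚ,
    ι₂ (algebraMap (v.adicCompletion ℚ) (AlgebraicClosure (v.adicCompletion ℚ)) x) =
      algebraMap (wp.adicCompletion (κ.layer n)) (AlgebraicClosure (wp.adicCompletion (κ.layer n)))
        (adicCompletionMap (K := ℚ) (κ.layer n) v wp x))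
  (ι' : AlgebraicClosure (κ.layer n) →ₐ[κ.layer n] AlgebraicClosure (wp.adicCompletion (κ.layer n)))
  (hcompat : ∀ z : AlgebraicClosure ℚ,
    ι' (closureEmb (K := ℚ) (κ.layer n) z) = ι₂ (closureEmb (K := ℚ) (v.adicCompletion ℚ) z))
  (hfix : ∀ h : absoluteGaloisGroup (v.adicCompletion ℚ),
    resGalOfEmb (closureEmb (K := ℚ) (v.adicCompletion ℚ)) h ∈ κ.layerSubgroup n →
    ∀ y : wp.adicCompletion (κ.layer n),
      (show AlgebraicClosure (v.adicCompletion ℚ) ≃ₐ[v.adicCompletion ℚ]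
          AlgebraicClosure (v.adicCompletion ℚ) from h)
        (ι₂.symm (algebraMap _ (AlgebraicClosure (wp.adicCompletion (κ.layer n))) y)) =
        ι₂.symm (algebraMap _ (AlgebraicClosure (wp.adicCompletion (κ.layer n))) y))
  (τ : Field.absoluteGaloisGroup (κ.layer n))
  (hτ : ι' = (closureEmb (K := κ.layer n) (wp.adicCompletion (κ.layer n))).comp
    ((show AlgebraicClosure (κ.layer n) ≃ₐ[κ.layer n] AlgebraicClosure (κ.layer n) from τ) :
      AlgebraicClosure (κ.layer n) →ₐ[κ.layer n] AlgebraicClosure (κ.layer n)))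

/-! ## §1. The good reduction of the minimal model over the valuation ring of `|·|_wp` -/

omit [W.IsElliptic] [wp.asIdeal.LiesOver v.asIdeal] in
/-- `W_ℤ ⊗ 𝒪_w ⊗ \bar L_w = (E ⊗ ℚ_n) ⊗ \bar L_w` (both are base changes of `integralModelInt W`).
[folklore] -/
theorem localIntModel_baseChange_layer (O : ValuationSubring (AlgebraicClosure (wp.adicCompletion (κ.layer n)))) :
    ((integralModelInt W).map (algebraMap ℤ O)).baseChange (AlgebraicClosure (wp.adicCompletion (κ.layer n))) =
      (W.baseChange (κ.layer n)).baseChange (AlgebraicClosure (wp.adicCompletion (κ.layer n))) := by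
  rw [baseChange_baseChange W (κ.layer n)]
  conv_rhs => rw [← map_integralModelInt W]
  rw [baseChange, baseChange, WeierstrassCurve.map_map, WeierstrassCurve.map_map]
  congr 1
  exact RingHom.ext_int _ _

omit [W.IsElliptic] in
include hpv hΔ in
/-- **Good reduction at `wp`**: the discriminant of `W_ℤ ⊗ 𝒪_w` is a unit for the spectral valuation
`w` of `\bar L_w` (`p ∤ Δ_W`, `wp ∋ p`). [cite: SilvermanAEC2009, VII.5.1(a)] -/
theorem isUnit_Δ_localIntModel_layer
    {w : Valuation (AlgebraicClosure (wp.adicCompletion (κ.layer n))) ℝ≥0}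
    (hw : ∀ x, (w x : ℝ) = spectralNorm (wp.adicCompletion (κ.layer n))
      (AlgebraicClosure (wp.adicCompletion (κ.layer n))) x) :
    IsUnit ((integralModelInt W).map (algebraMap ℤ w.valuationSubring)).Δ := by
  rw [map_Δ, (Valuation.valuationSubring.integers (v := w)).isUnit_iff_valuation_eq_one]
  change w (((integralModelInt W).Δ : ℤ) : AlgebraicClosure (wp.adicCompletion (κ.layer n))) = 1
  refine spectralValuation_intCast_eq_one hw fun hmem ↦ ?_
  -- `p ∈ wp` and `p ∤ Δ`: Bézout
  have hpw : ((p : ℕ) : 𝓞 (κ.layer n)) ∈ wp.asIdeal := by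
    have h1 : (algebraMap (𝓞 ℚ) (𝓞 (κ.layer n))) ((p : ℕ) : 𝓞 ℚ) ∈ wp.asIdeal := by
      rw [← Ideal.mem_comap]
      have h2 : v.asIdeal = wp.asIdeal.comap (algebraMap (𝓞 ℚ) (𝓞 (κ.layer n))) :=
        Ideal.LiesOver.over
      rw [← h2]; exact hpv
    rwa [map_natCast] at h1
  have hcop : IsCoprime (p : ℤ) (integralModelInt W).Δ :=
    (Prime.coprime_iff_not_dvd (Nat.prime_iff_prime_int.mp hp.out)).mpr hΔ
  obtain ⟨a, b, hab⟩ := hcop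
  apply wp.isPrime.ne_top
  rw [Ideal.eq_top_iff_one]
  have h1 : ((a * p + b * (integralModelInt W).Δ : ℤ) : 𝓞 (κ.layer n)) = 1 := by rw [hab, Int.cast_one]
  rw [← h1]
  push_cast
  exact wp.asIdeal.add_mem (wp.asIdeal.mul_mem_left _ hpw) (wp.asIdeal.mul_mem_left _ hmem)

/-! ## §2. Transport of torsion points of `E(\bar ℚ_v)` to `E_{ℚ_n}[p](\bar ℚ_n)` -/

include hpv hι₂ hcompat hτ in
/-- **A `p`-torsion point `P_v ∈ E(\bar ℚ_v)` comes from some `Q ∈ E_{ℚ_n}[p](\bar ℚ_n)` with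
`red_w(pointsMap Q) = Õ ↔ localRed P_v = Õ`** (`Q = τ • β(torsionPointsEquiv⁻¹ P_v)`; torsion is
algebraic, `pointsMap(τ • Q') = (ι')_* Q'`, and "reduces to `Õ`" transports along `ι₂`). Moreover
`Q ≠ 0` if `P_v ≠ 0`. [cite: SilvermanAEC2009, VII.§2–3] [cite: SerreGaloisCohomology1997, II.§1.1] -/
theorem exists_geomTorsion_red_iff
    {w : Valuation (AlgebraicClosure (wp.adicCompletion (κ.layer n))) ℝ≥0}
    (hw : ∀ x, (w x : ℝ) = spectralNorm (wp.adicCompletion (κ.layer n))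
      (AlgebraicClosure (wp.adicCompletion (κ.layer n))) x)
    {M : WeierstrassCurve ↥w.valuationSubring}
    (hMK : M.baseChange (AlgebraicClosure (wp.adicCompletion (κ.layer n))) =
      (W.baseChange (κ.layer n)).baseChange (AlgebraicClosure (wp.adicCompletion (κ.layer n))))
    {red : localPoints (W.baseChange (κ.layer n)) (wp.adicCompletion (κ.layer n)) →+
      (M.map (IsLocalRing.residue ↥w.valuationSubring)).toAffine.Point}
    (hred : ∀ P, red P = M.reducePoint (Affine.Point.congrEquiv hMK.symm P)) (hΔ' : IsUnit M.Δ)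
    (Pv : localPoints W (v.adicCompletion ℚ)) (hPv : (p : ℤ) • Pv = 0) :
    ∃ Q : geomTorsion (W.baseChange (κ.layer n)) (p : ℤ), (Pv ≠ 0 → Q ≠ 0) ∧
      (red (pointsMap (W.baseChange (κ.layer n)) (wp.adicCompletion (κ.layer n))
        (Q : WeierstrassCurve.geomPoints (W.baseChange (κ.layer n)))) = 0 ↔
        localRed W p hpv hΔ Pv = 0) := by
  have hp0 : (p : ℤ) ≠ 0 := by exact_mod_cast hp.out.ne_zero
  -- `P ∈ E[p](\bar ℚ)` with `pointsMap P = Pv`, `Ph` its image in `E[p^∞]`, `Q'` = `β Ph` as a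
  -- `p`-torsion point over `\bar ℚ_n`
  obtain ⟨P, hPv'⟩ : ∃ P : geomTorsion W (p : ℤ), pointsMap W (v.adicCompletion ℚ) (P : W.geomPoints) = Pv :=
    ⟨(W.torsionPointsEquiv (p : ℤ) (E := v.adicCompletion ℚ) hp0).symm ⟨Pv, hPv⟩,
      W.pointsMap_torsionPointsEquiv_symm (p : ℤ) hp0 ⟨Pv, hPv⟩⟩
  let Ph : W.geomPrimaryTorsion p := AddSubgroup.inclusion (geomTorsion_le_geomPrimaryTorsion W p) P
  have hPhP : (Ph : W.geomPoints) = (P : W.geomPoints) := rfl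
  have hQ'mem : ((primaryBaseChangeEquiv (κ.layer n) W p Ph :
      (W.baseChange (κ.layer n)).geomPrimaryTorsion p) :
        WeierstrassCurve.geomPoints (W.baseChange (κ.layer n))) ∈
      geomTorsion (W.baseChange (κ.layer n)) (p : ℤ) := by
    rw [mem_geomTorsion_iff, ← AddSubgroupClass.coe_zsmul, ← map_zsmul]
    have : (p : ℤ) • Ph = 0 := Subtype.ext ((mem_geomTorsion_iff W (p : ℤ) _).mp P.2)
    rw [this, map_zero]; rfl
  obtain ⟨Q', hQ'⟩ : ∃ Q' : geomTorsion (W.baseChange (κ.layer n)) (p : ℤ),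
      (Q' : WeierstrassCurve.geomPoints (W.baseChange (κ.layer n))) =
        ((primaryBaseChangeEquiv (κ.layer n) W p Ph :
          (W.baseChange (κ.layer n)).geomPrimaryTorsion p) :
            WeierstrassCurve.geomPoints (W.baseChange (κ.layer n))) := ⟨⟨_, hQ'mem⟩, rfl⟩
  refine ⟨τ • Q', fun hPv0 hQ0 ↦ hPv0 ?_, ?_⟩
  · -- `τ • Q' = 0 ⇒ Q' = 0 ⇒ Ph = 0 ⇒ P = 0 ⇒ Pv = 0`
    have hQ'0 : Q' = 0 := by
      have := congrArg (fun R ↦ τ⁻¹ • R) hQ0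
      simpa only [inv_smul_smul, smul_zero] using this
    have hval : ((primaryBaseChangeEquiv (κ.layer n) W p Ph :
        (W.baseChange (κ.layer n)).geomPrimaryTorsion p) :
          WeierstrassCurve.geomPoints (W.baseChange (κ.layer n))) = 0 := by
      rw [← hQ', hQ'0]; rfl
    have hPh0 : Ph = 0 := by
      apply (primaryBaseChangeEquiv (κ.layer n) W p).injective
      rw [map_zero]
      exact Subtype.ext hval
    have hP0 : (P : W.geomPoints) = 0 := by rw [← hPhP, hPh0]; rfl
    rw [← hPv', hP0, map_zero]
  · -- `pointsMap (τ • Q') = (ι')_* (β Ph)` and the transport of "reduces to `Õ`"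
    have h2 := congrArg (fun f ↦ f (Q' : WeierstrassCurve.geomPoints (W.baseChange (κ.layer n))))
      (pointsMapOfEmb_comp (W.baseChange (κ.layer n))
        (closureEmb (K := κ.layer n) (wp.adicCompletion (κ.layer n)))
        (show AlgebraicClosure (κ.layer n) ≃ₐ[κ.layer n] AlgebraicClosure (κ.layer n) from τ))
    rw [← hτ] at h2
    simp only [AddMonoidHom.coe_comp, Function.comp_apply, DistribSMul.toAddMonoidHom_apply] at h2
    -- `h2 : (ι')_* Q' = (ι_{L_w})_* (τ • Q')`
    have h1 : pointsMap (W.baseChange (κ.layer n)) (wp.adicCompletion (κ.layer n))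
        ((τ • Q' : geomTorsion (W.baseChange (κ.layer n)) (p : ℤ)) :
          WeierstrassCurve.geomPoints (W.baseChange (κ.layer n))) =
        pointsMapOfEmb (W.baseChange (κ.layer n)) ι'
          ((primaryBaseChangeEquiv (κ.layer n) W p Ph :
            (W.baseChange (κ.layer n)).geomPrimaryTorsion p) :
              WeierstrassCurve.geomPoints (W.baseChange (κ.layer n))) := by
      rw [← hQ', h2, Literature.NumberTheory.EllipticCurves.AddSubgroup.torsionBy.coe_smul]
      rfl
    rw [h1, LocalPackageTransportPoints.red_pointsMapOfEmb_eq_zero_iff W p hpv hΔ (κ.layer n) wp hw hMK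
      hred ι₂ hι₂ ι' hcompat hΔ', hPhP, hPv']

/-! ## §3. The local package at `wp` in raw form (the `K`-general package at `K = ℚ_n`) -/

set_option maxHeartbeats 800000 in -- many `ℚ`-level vs `K`-general instance unifications
-- (`Algebra ℚ ℚ_n` via `DivisionRing.toRatAlgebra` vs the layer's `IntermediateField.algebra`, equal
-- only after unfolding) — each costs ~10⁴–10⁵ heartbeats; the default cliff is hit half-way.
include hκn hpv hΔ hι₂ hcompat hfix hτ in
/-- **THE LOCAL PACKAGE at `wp`, raw form** (for a given reduction datum `(w, M, red)` at `wp`): there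
is `𝓛 ≤ H¹((ℚ_n)_wp, E[p])` with `𝓚_wp ≤ 𝓛`, `p² · #𝓚_wp ≤ #𝓛`, all of whose classes have cocycles
`ψ` with `red(pointsMap ψ(g)) = Õ` for every `g ∈ I_{(ℚ_n)_wp}` restricting into `Gal(ℚ̄/ℚ_{n,∞})` —
the `K`-general package `X1/LocalStrictPackage.exists_strict_addSubgroup` at `K = ℚ_n` with
`A₀ =` the reductions of `E[p]` (order `p`: the transported ordinary filtration), `ψ = κ_n ∘ res`
(`hI`, `hμ`, `hs_anom` from `X1/LocalPackageTransportGalois`; `ht` from the rational `p`-torsion).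
[cite: GreenbergLNM1716, §2 Prop. 2.4, §3 Lemma 3.4 (p. 89), §5 pp. 114–118]
[cite: MilneADT2006, I Thm. 2.8] [cite: SilvermanAEC2009, VII.§2–3] -/
theorem exists_addSubgroup_redStrict
    {w : Valuation (AlgebraicClosure (wp.adicCompletion (κ.layer n))) ℝ≥0}
    (hw : ∀ x, (w x : ℝ) = spectralNorm (wp.adicCompletion (κ.layer n))
      (AlgebraicClosure (wp.adicCompletion (κ.layer n))) x)
    {M : WeierstrassCurve ↥w.valuationSubring}
    (hMK : M.baseChange (AlgebraicClosure (wp.adicCompletion (κ.layer n))) =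
      (W.baseChange (κ.layer n)).baseChange (AlgebraicClosure (wp.adicCompletion (κ.layer n))))
    {red : localPoints (W.baseChange (κ.layer n)) (wp.adicCompletion (κ.layer n)) →+
      (M.map (IsLocalRing.residue ↥w.valuationSubring)).toAffine.Point}
    (hred : ∀ P, red P = M.reducePoint (Affine.Point.congrEquiv hMK.symm P)) (hΔ' : IsUnit M.Δ)
    (hκ : κ.IsCyclotomic) (hodd : p ≠ 2)
    (hord : ¬ (p : ℤ) ∣ W.frobeniusTrace p) (hT : ∃ T : W.toAffine.Point, addOrderOf T = p)
    (hEP : localEulerPoincareCharacteristic (wp.adicCompletion (κ.layer n))) :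
    ∃ 𝓛 : AddSubgroup (galoisCohomology (GaloisRep.restrictField (wp.adicCompletion (κ.layer n))
        ((W.baseChange (κ.layer n)).torsionGaloisModule (p : ℤ))) 1),
      (W.baseChange (κ.layer n)).kummerLocalConditionAt (p : ℤ) (wp.adicCompletion (κ.layer n)) ≤ 𝓛 ∧
      p ^ 2 * Nat.card ((W.baseChange (κ.layer n)).kummerLocalConditionAt (p : ℤ)
        (wp.adicCompletion (κ.layer n))) ≤ Nat.card 𝓛 ∧
      ∀ c ∈ 𝓛, ∀ ψc : contOneCocycles (GaloisRep.restrictField (wp.adicCompletion (κ.layer n))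
          ((W.baseChange (κ.layer n)).torsionGaloisModule (p : ℤ))).toTopRep,
        oneCocycleClass _ ψc = c →
        ∀ g : absoluteGaloisGroup (wp.adicCompletion (κ.layer n)),
          g ∈ absInertia (wp.adicCompletion (κ.layer n)) →
          absGaloisRestrict (κ.layer n) (wp.adicCompletion (κ.layer n)) g ∈ κn.kerSubgroup →
          red (pointsMap (W.baseChange (κ.layer n)) (wp.adicCompletion (κ.layer n))
            ((ψc.1 g : geomTorsion (W.baseChange (κ.layer n)) (p : ℤ)) :
              WeierstrassCurve.geomPoints (W.baseChange (κ.layer n)))) = 0 := by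
  have hp0 : (p : ℤ) ≠ 0 := by exact_mod_cast hp.out.ne_zero
  haveI : NeZero p := ⟨hp.out.ne_zero⟩
  haveI : Finite (geomTorsion (W.baseChange (κ.layer n)) (p : ℤ)) :=
    finite_geomTorsion_of_neZero (W.baseChange (κ.layer n)) p
  -- (2) the prime is anomalous (rational point of order `p`, `p ≥ 3`)
  have h3p : 3 ≤ p := Nat.succ_le_of_lt (lt_of_le_of_ne hp.out.two_le (Ne.symm hodd))
  obtain ⟨T, hTord⟩ := hT
  have hanom : p ∣ W.reductionPointCount p := dvd_reductionPointCount_of_addOrderOf_eq W p h3p hΔ hTord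
  -- (3) `s₀ = red ∘ pointsMap` on `E[p]`, its image `A₀` has order `p`
  -- (`s₀` as an OPAQUE local — a `let` body is unfolded by `isDefEq` and times out — and
  -- introduced by `Exists.elim`: `obtain` on a non-variable goes through `generalize`, which
  -- times out at `whnf` on this goal.)
  refine (?_ : ∃ s₀ : geomTorsion (W.baseChange (κ.layer n)) (p : ℤ) →+
      (M.map (IsLocalRing.residue ↥w.valuationSubring)).toAffine.Point,
      ∀ Q, s₀ Q = red (pointsMap (W.baseChange (κ.layer n)) (wp.adicCompletion (κ.layer n))
        (Q : WeierstrassCurve.geomPoints (W.baseChange (κ.layer n))))).elim fun s₀ hs₀ ↦ ?_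
  · exact ⟨red.comp ((pointsMap (W.baseChange (κ.layer n)) (wp.adicCompletion (κ.layer n))).comp
      (geomTorsion (W.baseChange (κ.layer n)) (p : ℤ)).subtype), fun _ ↦ rfl⟩
  have hwv := specVal_spec v
  have hΔu := W.isUnit_Δ_localIntModel hpv hwv hΔ
  haveI hcharw : CharP (IsLocalRing.ResidueField ((specVal v).valuationSubring)) p :=
    GoodModelLine.charP_residueField_specVal p hpv
  have hordA := W.exists_zsmul_eq_zero_localRed_ne_zero hwv hΔu (localRed W p hpv hΔ)
    (localRed_apply W p hpv hΔ) hpv hΔ hord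
  obtain ⟨hker, -, -⟩ := W.localRed_ordinary_filtration hΔu (localRed W p hpv hΔ)
    (localRed_apply W p hpv hΔ) hordA
  -- (NB: `obtain … := <application>` goes through `generalize` and times out at `whnf` in this
  -- context; existentials are NAMED by `have` first throughout this proof.)
  have hk : ∃ P₁ : localPoints W (v.adicCompletion ℚ), localRed W p hpv hΔ P₁ = 0 ∧ addOrderOf P₁ = p :=
    (hker 1).imp fun _ h ↦ ⟨h.1, h.2.1.trans (pow_one p)⟩
  obtain ⟨P₁, hP₁0, hP₁ord⟩ := hk
  obtain ⟨P₂, hP₂p, hP₂⟩ := hordA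
  have hP₁p : (p : ℤ) • P₁ = 0 := by
    rw [← hP₁ord, natCast_zsmul]
    exact addOrderOf_nsmul_eq_zero P₁
  have hP₁ne : P₁ ≠ 0 := by
    intro h
    rw [h, addOrderOf_zero] at hP₁ord
    exact hp.out.one_lt.ne hP₁ord
  have hQ₁ex := exists_geomTorsion_red_iff W κ n hpv hΔ wp ι₂ hι₂ ι' hcompat τ hτ hw hMK hred hΔ' P₁
    hP₁p
  have hQ₂ex := exists_geomTorsion_red_iff W κ n hpv hΔ wp ι₂ hι₂ ι' hcompat τ hτ hw hMK hred hΔ' P₂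
    hP₂p
  obtain ⟨Q₁, hQ₁ne, hQ₁red⟩ := hQ₁ex
  obtain ⟨Q₂, -, hQ₂red⟩ := hQ₂ex
  have hA₀ : Nat.card s₀.range = p :=
    LocalPackageParts.natCard_range_eq_of_card_eq_sq s₀ hp.out
      (by rw [natCard_geomTorsion _ (p : ℤ) hp0, Int.natAbs_natCast])
      ⟨Q₁, hQ₁ne hP₁ne, (hs₀ Q₁).trans (hQ₁red.mpr hP₁0)⟩
      ⟨Q₂, fun h ↦ hP₂ (hQ₂red.mp ((hs₀ Q₂).symm.trans h))⟩
  -- (4) the `K`-general package at `K = ℚ_n`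
  -- (`ψ = κ_n ∘ res` as an opaque local, like `s₀`)
  refine (⟨κn.toContinuousMonoidHom.comp (absGaloisRestrict (κ.layer n) (wp.adicCompletion (κ.layer n))),
    fun _ ↦ rfl⟩ : ∃ ψ : absoluteGaloisGroup (wp.adicCompletion (κ.layer n)) →ₜ* Multiplicative ℤ_[p],
      ∀ g, ψ g = κn (absGaloisRestrict (κ.layer n) (wp.adicCompletion (κ.layer n)) g)).elim
    fun ψ hψ ↦ ?_
  have hI : ∃ g ∈ absInertia (wp.adicCompletion (κ.layer n)), ¬ (p : ℤ_[p]) ∣ (ψ g).toAdd := by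
    have h := LocalPackageTransportGalois.exists_absInertia_not_dvd κ n κn hκn hpv wp ι₂ hι₂ ι'
      hcompat hfix τ hτ hκ
    obtain ⟨g, hgI, hg⟩ := h
    exact ⟨g, hgI, fun hdvd ↦ hg (by rw [← hψ g]; exact hdvd)⟩
  have hψH : ∀ g, absGaloisRestrict (κ.layer n) (wp.adicCompletion (κ.layer n)) g ∈ κn.kerSubgroup →
      ψ g = 1 := fun g hg ↦ by
    rw [hψ g]; exact ZpExtension.mem_kerSubgroup.mp hg
  haveI : Finite s₀.range := Finite.of_surjective s₀.rangeRestrict s₀.rangeRestrict_surjective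
  have hs_red : ∀ Q, s₀.rangeRestrict Q = 0 ↔
      red (pointsMap (W.baseChange (κ.layer n)) (wp.adicCompletion (κ.layer n))
        (Q : WeierstrassCurve.geomPoints (W.baseChange (κ.layer n)))) = 0 := fun Q ↦ by
    constructor
    · intro h
      have h' : ((s₀.rangeRestrict Q : s₀.range) :
          (M.map (IsLocalRing.residue ↥w.valuationSubring)).toAffine.Point) =
          ((0 : s₀.range) : (M.map (IsLocalRing.residue ↥w.valuationSubring)).toAffine.Point) :=
        congrArg Subtype.val h
      have h'' : s₀ Q = 0 := h'
      rw [hs₀ Q] at h''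
      exact h''
    · intro h
      apply Subtype.ext
      have h'' : s₀ Q = 0 := by rw [hs₀ Q]; exact h
      exact h''
  have h𝓛ex := LocalStrictPackage.exists_strict_addSubgroup (W.baseChange (κ.layer n))
    p wp hw hMK hred κn.kerSubgroup (↥s₀.range) hA₀ s₀.rangeRestrict hs_red
    (fun g Q ↦ Subtype.ext (by
      change s₀ _ = s₀ Q
      rw [hs₀, hs₀]
      exact LocalPackageTransportGalois.red_pointsMap_smul_eq W κ n hpv hΔ wp hw hMK hred ι₂ hι₂ ι'
        hcompat τ hτ hord hanom hΔ' g Q))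
    ψ hI hψH hEP
    (LocalPackageTransportGalois.forall_mu_eq_zero κ n hpv wp ι₂ hfix hκ hodd)
    (LocalPackageParts.le_natCard_ker_nsmul W (κ.layer n) wp hTord)
  exact h𝓛ex

end Summit.BirchSwinnertonDyer.Rank1Residual.X1.LocalPackageRat

end
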